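import Summits.QuantumFields.YangMills.Theorems.FlatTubeReductionFibredBOProj
import HarnessLib

/-!
# Fibred Born–Oppenheimer blocks — part 10: linearity of the fibred adiabatic projection in the state (2-families and their combinations)
# (route `FlatTubeReduction`, crux K1 `NearFlatRatioLaw` stmt-QuantumFields-24720, registered stub `stub_boRate` = FCL 23943's `BORateAll`;
# rung R2b1 = RECORD-label femto gap; no summit statement is proved here)

Seat `ym-line-ftr-p1` g6 (prover).  The registered stub quantifies over bounded measurable 2-families `G₀, G₁` and ALL their linear combinations
`G_a = Σ aᵢGᵢ`, asking for families `φᵢ` (lattice) and `gᵢ` (one-site) whose combinations `φ_a, g_a` satisfy (P1)(P3)(P4)(P5)(P6).  With `φᵢ := PGᵢ`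
(`fibredProj`) everything is linear: `P(Σ aᵢGᵢ) = Σ aᵢPGᵢ`, `(1−P)(Σ aᵢGᵢ) = Σ aᵢ(1−P)Gᵢ`, and the slow coefficient (hence the dressed one-site profile
`g = f√λ` of `…FibredBOLinear`) is linear too — so the blocks, proved for one state, apply to every combination with `f_a = Σ aᵢfᵢ`.
* `fibredCoeff_const_mul`, `fibredCoeff_add`, ★ `fibredCoeff_sum` — linearity of `f = ∫ Φ_cΩ_c dπ` (finite sums need fibrewise integrability of `GᵢΩ_c`);
* ★ `fibredProj_sum`, ★ `fibredOrth_sum` — `P` and `1 − P` commute with finite linear combinations.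
HONEST FRAMING: bookkeeping for the registered stub of a crux of the CONDITIONAL reduction route to the femto rung R2b1 (RECORD label); nothing here is infinite
volume, a continuum limit or the Clay mass gap.  No definitions, no named facts, no `sorry`.

## References
* S. J. Gustafson, I. M. Sigal, *Mathematical Concepts of Quantum Mechanics*, Springer 2003, §12 — [cite: GustafsonSigal2003, §12].
-/

set_option autoImplicit false

noncomputable section

open MeasureTheory
open scoped BigOperators

namespace Summit.QuantumFields.YangMills.Theorems.FemtoTransferGap.FibredBO

variable {C Q : Type*} [MeasurableSpace Q] {π : Measure Q} {Ω : C → Q → ℝ}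

/-- `f(aΦ) = a·f(Φ)`. [folklore] -/
theorem fibredCoeff_const_mul (a : ℝ) (Φ : C × Q → ℝ) (c : C) :
    fibredCoeff π Ω (fun x => a * Φ x) c = a * fibredCoeff π Ω Φ c := by
  unfold fibredCoeff
  rw [← integral_const_mul]
  refine integral_congr_ae (ae_of_all _ fun q => ?_)
  ring

/-- `f(Φ + Ψ) = f(Φ) + f(Ψ)` (fibrewise integrability). [folklore] -/
theorem fibredCoeff_add (Φ Ψ : C × Q → ℝ) (c : C) (hΦ : Integrable (fun q => Φ (c, q) * Ω c q) π)
    (hΨ : Integrable (fun q => Ψ (c, q) * Ω c q) π) :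
    fibredCoeff π Ω (fun x => Φ x + Ψ x) c = fibredCoeff π Ω Φ c + fibredCoeff π Ω Ψ c := by
  unfold fibredCoeff
  rw [← integral_add hΦ hΨ]
  refine integral_congr_ae (ae_of_all _ fun q => ?_)
  ring

/-- ★ `f(Σ aᵢGᵢ) = Σ aᵢ f(Gᵢ)` for a finite family with fibrewise integrable `GᵢΩ_c`. [cite: GustafsonSigal2003, §12] -/
theorem fibredCoeff_sum {ι : Type*} [Fintype ι] (a : ι → ℝ) (G : ι → C × Q → ℝ) (c : C)
    (hG : ∀ i, Integrable (fun q => G i (c, q) * Ω c q) π) :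
    fibredCoeff π Ω (fun x => ∑ i, a i * G i x) c = ∑ i, a i * fibredCoeff π Ω (G i) c := by
  unfold fibredCoeff
  have e : (fun q => (∑ i, a i * G i (c, q)) * Ω c q) = fun q => ∑ i, a i * (G i (c, q) * Ω c q) := by
    funext q
    rw [Finset.sum_mul]
    refine Finset.sum_congr rfl fun i _ => ?_
    ring
  rw [e, integral_finsetSum _ fun i _ => (hG i).const_mul (a i)]
  refine Finset.sum_congr rfl fun i _ => ?_
  exact integral_const_mul _ _

/-- ★ `P(Σ aᵢGᵢ) = Σ aᵢ PGᵢ` pointwise. [cite: GustafsonSigal2003, §12] -/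
theorem fibredProj_sum {ι : Type*} [Fintype ι] (a : ι → ℝ) (G : ι → C × Q → ℝ)
    (hG : ∀ i c, Integrable (fun q => G i (c, q) * Ω c q) π) (x : C × Q) :
    fibredProj π Ω (fun y => ∑ i, a i * G i y) x = ∑ i, a i * fibredProj π Ω (G i) x := by
  unfold fibredProj
  rw [fibredCoeff_sum a G x.1 fun i => hG i x.1, Finset.sum_mul]
  refine Finset.sum_congr rfl fun i _ => ?_
  ring

/-- ★ `(1−P)(Σ aᵢGᵢ) = Σ aᵢ (1−P)Gᵢ` pointwise. [cite: GustafsonSigal2003, §12] -/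
theorem fibredOrth_sum {ι : Type*} [Fintype ι] (a : ι → ℝ) (G : ι → C × Q → ℝ)
    (hG : ∀ i c, Integrable (fun q => G i (c, q) * Ω c q) π) (x : C × Q) :
    fibredOrth π Ω (fun y => ∑ i, a i * G i y) x = ∑ i, a i * fibredOrth π Ω (G i) x := by
  unfold fibredOrth
  rw [fibredProj_sum a G hG x, ← Finset.sum_sub_distrib]
  refine Finset.sum_congr rfl fun i _ => ?_
  ring

end Summit.QuantumFields.YangMills.Theorems.FemtoTransferGap.FibredBO

end
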